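import Summits.HodgeConjecture.HodgeConjecture.Theses.NikulinTwinTransport
import Summits.HodgeConjecture.HodgeConjecture.Theorems.NikulinTwinTransportTwinSimilitudeAlgebraicMarkings
import Summits.HodgeConjecture.HodgeConjecture.Theorems.NikulinTwinTransportTwinSimilitudeAlgebraicLattice
import Literature.AlgebraicGeometry.Surfaces.K3Marking

/-!
# Route NikulinTwinTransport · `TwinExists` (stmt-HodgeConjecture-13677) — the universal twin,
# from markings, surjectivity of the period map and the Hodge types of `H²(K3)`

The route item `TwinExists` (support, rank 9): every projective K3 surface `S` has a projective K3
partner `S'` together with integral generators `p, p'` of `H⁴` and a rational, type-preserving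
`2`-similitude `ψ : H²(S'(ℂ); ℂ) → H²(S(ℂ); ℂ)` (`(x.y) = a p' ⟹ (ψx.ψy) = 2a p`).

PROOF (the route's own: "mark `S`, push the period through the inverse of the integral
`2`-similitude `M` of `Λ_{K3}` and apply `Huybrechts_K3_periodSurjective_projective`"), assembled
from the helper files of the target item (`…TwinSimilitudeAlgebraicMarkings`,
`…TwinSimilitudeAlgebraicLattice`): mark `S` by `η : H²(S(ℂ); ℂ) ≅ Λ_ℂ` with period `x` and
generator `p` of `H⁴` (`Huybrechts_K3_marking_exists`); take the rational `2`-similitude `M` of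
`(Λ_ℂ, k3Form)` with rational inverse `N` (`exists_twoSimilitude_k3Lattice`: sum/difference on
`E₈(−1)^{⊕2}`, `diag(1,2)` on each `U`); the twin period `N x` is again a projective period point
(`periodPt_twin`: `N` is real and carries a positive lattice vector of `x^⊥` to a positive rational
vector of `(N x)^⊥`) and is realised by a marked projective K3 surface `(S', η', p')`
(`Huybrechts_K3_periodSurjective_projective`); then `ψ := η⁻¹ ∘ M ∘ η'` is rational
(`isRationalClass_markingConj`), multiplies cup products by `2` (`cupProduct_markingConj`) and
preserves every Hodge type (`isOfHodgeType_markingConj`, through `Huybrechts_K3_hodgeTypes_H2`: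
`M (N x) = x` carries the period line to the period line, reality gives `(0,2)`, orthogonality
gives `(1,1)`, the other types carry only `0`).

CONDITIONAL on exactly the three named facts of `Literature/AlgebraicGeometry/Surfaces`
(Huybrechts, *Lectures on K3 Surfaces*: Ch. 1 Prop. 3.5; Ch. 6 Thm. 3.1 / Rem. 3.3 with Ch. 7
Thm. 4.1; Ch. 6 Prop. 1.2), all undischarged in the tree; nothing else.
-/

noncomputable section

open CategoryTheory MonoidalCategory
open Literature.AlgebraicGeometry.Motives Literature.AlgebraicGeometry.HodgeTheory
open Literature.AlgebraicGeometry.Surfaces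
open Literature.AlgebraicTopology.SingularHomology

namespace Summit.HodgeConjecture.HodgeConjecture.Theorems

open NikulinTwinTransport

/-- **The universal twin, granted the three K3 facts.** For every projective K3 surface `S`
there are a projective K3 surface `S'`, integral generators `p, p'` of `H⁴(S(ℂ))`, `H⁴(S'(ℂ))` and
a rational, type-preserving `ℂ`-linear `2`-similitude `ψ : H²(S'(ℂ); ℂ) → H²(S(ℂ); ℂ)` — the route
decl `TwinExists` — assuming markings exist (`Huybrechts_K3_marking_exists`, Huybrechts Ch. 1
Prop. 3.5), the projective surjectivity of the period map
(`Huybrechts_K3_periodSurjective_projective`, Ch. 6 Rem. 3.3 / Ch. 7 Thm. 4.1) and the Hodge types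
of `H²(K3)` (`Huybrechts_K3_hodgeTypes_H2`, Ch. 6 Prop. 1.2). Construction: `S'` realises the twin
period `N x` of a marking `(η, x)` of `S`, `N = M⁻¹` for the rational `2`-similitude `M` of the K3
lattice, and `ψ = η⁻¹ ∘ M ∘ η'`. [cite: Huybrechts2016K3, Ch. 1 Prop. 3.5; Ch. 6 Prop. 1.2, Thm. 3.1 and Rem. 3.3; Ch. 7 Thm. 4.1] -/
theorem twinExists_of_marking_periodSurjective_hodgeTypes
    (hMk : Huybrechts_K3_marking_exists)
    (hP : Huybrechts_K3_periodSurjective_projective)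
    (hHT : Huybrechts_K3_hodgeTypes_H2) :
    Theses.NikulinTwinTransport.TwinExists := by
  unfold Theses.NikulinTwinTransport.TwinExists
  intro S hS
  have hSK : IsK3Surface S := hS
  -- the rational `2`-similitude `M` of the K3 lattice and its inverse `N`, a `½`-similitude
  obtain ⟨M, N, hMrat, hNrat, hMN, -, hM2⟩ := exists_twoSimilitude_k3Lattice
  have hN2 : ∀ a b, k3Form (N a) (N b) = (2 : ℂ)⁻¹ * k3Form a b := fun a b => by
    have h := hM2 (N a) (N b)
    rw [← Module.End.mul_apply (f := M), ← Module.End.mul_apply (f := M), hMN,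
      Module.End.one_apply, Module.End.one_apply] at h
    rw [h]
    ring
  -- a marking `η` of `S` with generator `p` of `H⁴` and projective period point `x`
  obtain ⟨η, p, x, -, hm, hx⟩ := hMk S hSK
  -- the twin period `N x` is a projective period point, realised by a marked projective `S'`
  have hx' := periodPt_twin N hNrat hN2 hx
  obtain ⟨S', hSK', η', p', hm'⟩ := hP (N x) hx'.1 hx'.2.1 hx'.2.2
  have hp'0 : p' ≠ 0 := generator_ne_zero hSK' hm'.2.1
  have hper : ∃ t : ℂ, M (N x) = t • x :=
    ⟨1, by rw [← Module.End.mul_apply (f := M), hMN, Module.End.one_apply, one_smul]⟩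
  -- the twin similitude `ψ = η⁻¹ ∘ M ∘ η'`
  refine ⟨S', p, p', η.symm.toLinearMap ∘ₗ M ∘ₗ η'.toLinearMap, hSK', ⟨hm.1, hm.2.1⟩,
    ⟨hm'.1, hm'.2.1⟩, ?_, ?_, ?_⟩
  · intro y hy
    exact isRationalClass_markingConj η η' M hSK hSK' hm.2.2.1 hm'.2.2.1 hMrat hy
  · intro i j y hy
    exact isOfHodgeType_markingConj η p x η' p' (N x) M hHT hSK hSK' hm.2.2.1 hm.2.2.2.1
      hm.2.2.2.2.1 hx.2.1 hm'.2.2.1 hm'.2.2.2.1 hp'0 hm'.2.2.2.2.1 hx'.2.1 hMrat two_ne_zero hM2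
      hper i j y hy
  · intro y z a h
    exact cupProduct_markingConj η p η' p' M hp'0 hm.2.2.2.1 hm'.2.2.2.1 hM2 y z a h

end Summit.HodgeConjecture.HodgeConjecture.Theorems

end
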